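import Summits.CriticalPhenomena.PercolationContinuityZ3.Theorems.AdditiveGluing.Negative.CertWeighted
import HarnessLib

/-!
# `NoHeavyLowerTail` (stmt-CriticalPhenomena-4575) — the RELIABLE CORNER of a finite weighted graph:
# leading-order asymptotics of `prodBernoulli` along the ray `w_e = 1 − ε·λ_e`

Support file of the coupling seat's CORNER programme (memo `A5-COUPLING-gen2.md` §4, gen 3): every inequality
of the crux's ladder (event gluing EG, worst-first gluing, CIL, BCR) has an exact LEADING-ORDER shadow near the
all-open corner, where probabilities are weighted counts of minimum closed sets (cuts).  This file is the
analytic half of that dictionary, for an ARBITRARY event on an arbitrary finite coordinate type: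

* `Corner.cornerWeight E lam ε` — the parameter vector `1 − ε·λ_i` on the finite support `E` (clamped to `[0,1]`),
  `0` off `E`;
* `Corner.real_eq_sum_powerset` — for `0 ≤ ε·λ_i ≤ 1` on `E`, the probability of ANY event `D` is
  `Σ_{S ⊆ E, S ∈ D} ε^{|E∖S|} (∏_{i ∈ E∖S} λ_i) ∏_{i ∈ S} (1 − ε λ_i)` (`S` = open set, `E∖S` = closed set);
* `Corner.tendsto_real_div_pow` — if every `S ⊆ E` with `S ∈ D` has at least `m` closed coordinates, then
  `P_ε(D) / ε^m → L_m(D) := Σ_{S ⊆ E, S ∈ D, |E∖S| = m} ∏_{i ∈ E∖S} λ_i` as `ε → 0⁺` (the leading coefficient;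
  `0` when the order of `D` exceeds `m`);
* consequences used by the corner theorems: limits of ratios (`tendsto_real_div_real`), passage of a product
  inequality `P(D₁)P(D₂) ≤ P(D₃)P(D₄)` (e.g. the tripod exchange C⁺) to leading coefficients
  (`leading_mul_le_of_real_mul_le`), and eventual domination (`eventually_real_le_mul_of_leading_le`).

Everything is [folklore] bookkeeping for product measures (polynomial dependence on the parameters); nothing here
asserts anything about the crux.
-/

noncomputable section

namespace Summit.CriticalPhenomena.PercolationContinuityZ3.Theorems

open MeasureTheory Filter Topology
open Literature.Probability.LatticeModels Literature.Probability.Percolation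
open Summit.CriticalPhenomena.PercolationContinuityZ3.Theorems.AdditiveGluing.Negative.Cert

namespace Corner

open scoped Classical

variable {ι : Type*}

/-- **Corner weights**: `1 − ε·λ_i` (clamped to `[0,1]`) on the support `E`, `0` off `E`. [folklore] -/
def cornerWeight (E : Finset ι) (lam : ι → ℝ) (ε : ℝ) : ι → unitInterval :=
  fun i => if i ∈ E then Set.projIcc (0 : ℝ) 1 zero_le_one (1 - ε * lam i) else 0

/-- Off the support the corner weight is `0`. [folklore] -/
theorem cornerWeight_of_not_mem (E : Finset ι) (lam : ι → ℝ) (ε : ℝ) {i : ι} (hi : i ∉ E) :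
    cornerWeight E lam ε i = 0 := by
  simp [cornerWeight, hi]

/-- On the support, for `0 ≤ ε λ_i ≤ 1`, the corner weight is `1 − ε λ_i`. [folklore] -/
theorem coe_cornerWeight_of_mem (E : Finset ι) (lam : ι → ℝ) (ε : ℝ) {i : ι} (hi : i ∈ E)
    (h0 : 0 ≤ ε * lam i) (h1 : ε * lam i ≤ 1) :
    (cornerWeight E lam ε i : ℝ) = 1 - ε * lam i := by
  simp only [cornerWeight, if_pos hi]
  rw [Set.projIcc_of_mem _ ⟨by linarith, by linarith⟩]

/-- The leading coefficient of order `m` of the event `D` at the corner: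
`L_m(D) = Σ_{S ⊆ E, S ∈ D, |E∖S| = m} ∏_{i ∈ E∖S} λ_i`. [folklore] -/
def leading (E : Finset ι) (lam : ι → ℝ) (D : Set (Set ι)) (m : ℕ) : ℝ :=
  ∑ S ∈ E.powerset, if (↑S : Set ι) ∈ D ∧ (E \ S).card = m then ∏ i ∈ E \ S, lam i else 0

/-- The regular part `g(ε) = Σ_{S ⊆ E, S ∈ D} ε^{|E∖S| − m} (∏_{E∖S} λ) ∏_{i∈S}(1 − ελ_i)` with
`P_ε(D) = ε^m g(ε)` when `D` has order `≥ m`. [folklore] -/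
def regularPart (E : Finset ι) (lam : ι → ℝ) (D : Set (Set ι)) (m : ℕ) (ε : ℝ) : ℝ :=
  ∑ S ∈ E.powerset, if (↑S : Set ι) ∈ D then
    ε ^ ((E \ S).card - m) * (∏ i ∈ E \ S, lam i) * ∏ i ∈ S, (1 - ε * lam i) else 0

/-- The cylinder weight of the open set `S ⊆ E` at the corner factorises as
`ε^{|E∖S|} (∏_{E∖S} λ) ∏_{S} (1 − ελ)`. [folklore] -/
theorem prod_cylinder_eq (E : Finset ι) (lam : ι → ℝ) (ε : ℝ) {S : Finset ι} (hS : S ⊆ E)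
    (hε : ∀ i ∈ E, 0 ≤ ε * lam i ∧ ε * lam i ≤ 1) :
    (∏ i ∈ E, (if i ∈ S then (cornerWeight E lam ε i : ℝ) else 1 - (cornerWeight E lam ε i : ℝ))) =
      ε ^ (E \ S).card * (∏ i ∈ E \ S, lam i) * ∏ i ∈ S, (1 - ε * lam i) := by
  classical
  have hsplit := Finset.prod_ite (s := E) (p := fun i => i ∈ S)
    (f := fun i => (cornerWeight E lam ε i : ℝ)) (g := fun i => 1 - (cornerWeight E lam ε i : ℝ))
  rw [hsplit, Finset.filter_mem_eq_inter, Finset.inter_eq_right.2 hS, Finset.filter_not,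
    Finset.filter_mem_eq_inter, Finset.inter_eq_right.2 hS]
  have h1 : ∏ i ∈ S, (cornerWeight E lam ε i : ℝ) = ∏ i ∈ S, (1 - ε * lam i) :=
    Finset.prod_congr rfl fun i hi =>
      coe_cornerWeight_of_mem E lam ε (hS hi) (hε i (hS hi)).1 (hε i (hS hi)).2
  have h2 : ∏ i ∈ E \ S, (1 - (cornerWeight E lam ε i : ℝ)) = ∏ i ∈ E \ S, (ε * lam i) :=
    Finset.prod_congr rfl fun i hi => by
      have hiE : i ∈ E := (Finset.mem_sdiff.1 hi).1
      rw [coe_cornerWeight_of_mem E lam ε hiE (hε i hiE).1 (hε i hiE).2]; ring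
  rw [h1, h2, Finset.prod_mul_distrib, Finset.prod_const]
  ring

/-- **Counting normal form at the corner.** For `0 ≤ ε λ_i ≤ 1` on `E`, the probability of any event is
`Σ_{S ⊆ E, S ∈ D} ε^{|E∖S|} (∏_{E∖S} λ) ∏_{S}(1 − ελ)`. [folklore] -/
theorem real_eq_sum_powerset [Fintype ι] (E : Finset ι) (lam : ι → ℝ) (ε : ℝ)
    (hε : ∀ i ∈ E, 0 ≤ ε * lam i ∧ ε * lam i ≤ 1) (D : Set (Set ι)) :
    (prodBernoulli (cornerWeight E lam ε)).real D =
      ∑ S ∈ E.powerset, if (↑S : Set ι) ∈ D then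
        ε ^ (E \ S).card * (∏ i ∈ E \ S, lam i) * ∏ i ∈ S, (1 - ε * lam i) else 0 := by
  classical
  rw [prodBernoulli_real_eq_sum_powerset_of_support (cornerWeight E lam ε) E
    (fun i hi => cornerWeight_of_not_mem E lam ε hi) D]
  refine Finset.sum_congr rfl fun S hS => ?_
  split_ifs with hSD
  · exact prod_cylinder_eq E lam ε (Finset.mem_powerset.1 hS) hε
  · rfl

/-- For `ε > 0` with `ε λ_i ≤ 1` (and `λ ≥ 0`) on `E`, and `D` of order `≥ m`: `P_ε(D) = ε^m · g(ε)`. [folklore] -/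
theorem real_eq_pow_mul_regularPart [Fintype ι] (E : Finset ι) (lam : ι → ℝ) (D : Set (Set ι)) (m : ℕ)
    (hm : ∀ S ∈ E.powerset, (↑S : Set ι) ∈ D → m ≤ (E \ S).card) {ε : ℝ}
    (hε : ∀ i ∈ E, 0 ≤ ε * lam i ∧ ε * lam i ≤ 1) :
    (prodBernoulli (cornerWeight E lam ε)).real D = ε ^ m * regularPart E lam D m ε := by
  classical
  rw [real_eq_sum_powerset E lam ε hε D, regularPart, Finset.mul_sum]
  refine Finset.sum_congr rfl fun S hS => ?_
  split_ifs with hSD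
  · rw [← mul_assoc, ← mul_assoc, ← pow_add, Nat.add_sub_cancel' (hm S hS hSD)]
  · simp

/-- The regular part is continuous in `ε`. [folklore] -/
theorem continuous_regularPart (E : Finset ι) (lam : ι → ℝ) (D : Set (Set ι)) (m : ℕ) :
    Continuous (regularPart E lam D m) := by
  classical
  unfold regularPart
  refine continuous_finsetSum _ fun S _ => ?_
  split_ifs
  · exact ((continuous_pow _).mul continuous_const).mul
      (continuous_finsetProd _ fun i _ => continuous_const.sub (continuous_id.mul continuous_const))
  · exact continuous_const

/-- At `ε = 0` the regular part is the leading coefficient of order `m` (for `D` of order `≥ m`). [folklore] -/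
theorem regularPart_zero (E : Finset ι) (lam : ι → ℝ) (D : Set (Set ι)) (m : ℕ)
    (hm : ∀ S ∈ E.powerset, (↑S : Set ι) ∈ D → m ≤ (E \ S).card) :
    regularPart E lam D m 0 = leading E lam D m := by
  classical
  unfold regularPart leading
  refine Finset.sum_congr rfl fun S hS => ?_
  by_cases hSD : (↑S : Set ι) ∈ D
  · have hprod : ∏ i ∈ S, (1 - (0 : ℝ) * lam i) = 1 := Finset.prod_eq_one fun i _ => by ring
    rw [if_pos hSD, hprod, mul_one]
    by_cases hk : (E \ S).card = m
    · rw [if_pos ⟨hSD, hk⟩, hk, Nat.sub_self, pow_zero, one_mul]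
    · have hlt : m < (E \ S).card := lt_of_le_of_ne (hm S hS hSD) (Ne.symm hk)
      rw [if_neg (fun h => hk h.2), zero_pow (Nat.sub_ne_zero_of_lt hlt), zero_mul]
  · rw [if_neg hSD, if_neg (fun h => hSD h.1)]

/-- Eventually along `ε → 0⁺` the corner weights are unclamped: `0 < ε` and `0 ≤ ε λ_i ≤ 1` on `E`
(for `λ ≥ 0` on `E`). [folklore] -/
theorem eventually_small (E : Finset ι) (lam : ι → ℝ) (hlam : ∀ i ∈ E, 0 ≤ lam i) :
    ∀ᶠ ε in 𝓝[>] (0 : ℝ), 0 < ε ∧ ∀ i ∈ E, 0 ≤ ε * lam i ∧ ε * lam i ≤ 1 := by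
  have hM : 0 < 1 + ∑ i ∈ E, lam i := by
    have := Finset.sum_nonneg hlam; linarith
  have hI : Set.Ioo (0 : ℝ) (1 / (1 + ∑ i ∈ E, lam i)) ∈ 𝓝[>] (0 : ℝ) :=
    Ioo_mem_nhdsGT (by positivity)
  filter_upwards [hI] with ε hε
  refine ⟨hε.1, fun i hi => ⟨mul_nonneg hε.1.le (hlam i hi), ?_⟩⟩
  have hle : lam i ≤ 1 + ∑ j ∈ E, lam j := by
    have := Finset.single_le_sum (f := lam) (fun j hj => hlam j hj) hi; linarith
  calc ε * lam i ≤ (1 / (1 + ∑ j ∈ E, lam j)) * (1 + ∑ j ∈ E, lam j) :=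
        mul_le_mul hε.2.le hle (hlam i hi) (by positivity)
    _ = 1 := by field_simp

/-- **Leading order at the corner.** If every open set `S ⊆ E` realising `D` has at least `m` closed
coordinates, then `P_ε(D)/ε^m → L_m(D)` as `ε → 0⁺` (`λ ≥ 0` on `E`). [folklore] -/
theorem tendsto_real_div_pow [Fintype ι] (E : Finset ι) (lam : ι → ℝ) (hlam : ∀ i ∈ E, 0 ≤ lam i)
    (D : Set (Set ι)) (m : ℕ) (hm : ∀ S ∈ E.powerset, (↑S : Set ι) ∈ D → m ≤ (E \ S).card) :
    Tendsto (fun ε => (prodBernoulli (cornerWeight E lam ε)).real D / ε ^ m) (𝓝[>] 0)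
      (𝓝 (leading E lam D m)) := by
  have hg : Tendsto (regularPart E lam D m) (𝓝[>] 0) (𝓝 (leading E lam D m)) := by
    rw [← regularPart_zero E lam D m hm]
    exact ((continuous_regularPart E lam D m).tendsto 0).mono_left nhdsWithin_le_nhds
  refine hg.congr' ?_
  filter_upwards [eventually_small E lam hlam] with ε hε
  rw [real_eq_pow_mul_regularPart E lam D m hm hε.2, mul_div_cancel_left₀ _ (pow_ne_zero m hε.1.ne')]

/-- The leading coefficient is nonnegative (`λ ≥ 0` on `E`). [folklore] -/
theorem leading_nonneg (E : Finset ι) (lam : ι → ℝ) (hlam : ∀ i ∈ E, 0 ≤ lam i) (D : Set (Set ι)) (m : ℕ) :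
    0 ≤ leading E lam D m := by
  classical
  unfold leading
  refine Finset.sum_nonneg fun S _ => ?_
  split_ifs
  · exact Finset.prod_nonneg fun i hi => hlam i (Finset.mem_sdiff.1 hi).1
  · exact le_rfl

/-- **Ratio limit.** For two events of order `≥ m` with `L_m(D₂) ≠ 0`:
`P_ε(D₁)/P_ε(D₂) → L_m(D₁)/L_m(D₂)`. [folklore] -/
theorem tendsto_real_div_real [Fintype ι] (E : Finset ι) (lam : ι → ℝ) (hlam : ∀ i ∈ E, 0 ≤ lam i)
    (D₁ D₂ : Set (Set ι)) (m : ℕ)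
    (h₁ : ∀ S ∈ E.powerset, (↑S : Set ι) ∈ D₁ → m ≤ (E \ S).card)
    (h₂ : ∀ S ∈ E.powerset, (↑S : Set ι) ∈ D₂ → m ≤ (E \ S).card) (hL : leading E lam D₂ m ≠ 0) :
    Tendsto (fun ε => (prodBernoulli (cornerWeight E lam ε)).real D₁ /
        (prodBernoulli (cornerWeight E lam ε)).real D₂) (𝓝[>] 0)
      (𝓝 (leading E lam D₁ m / leading E lam D₂ m)) := by
  have h := (tendsto_real_div_pow E lam hlam D₁ m h₁).div (tendsto_real_div_pow E lam hlam D₂ m h₂) hL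
  refine h.congr' ?_
  filter_upwards [eventually_small E lam hlam] with ε hε
  have hpow : ε ^ m ≠ 0 := pow_ne_zero m hε.1.ne'
  simp only [Pi.div_apply]
  rw [div_div_div_cancel_right₀ hpow]

/-- **Product inequalities pass to leading coefficients.** If `P_ε(D₁)P_ε(D₂) ≤ P_ε(D₃)P_ε(D₄)` for all small
`ε > 0` and the four events have order `≥ m`, then `L_m(D₁)L_m(D₂) ≤ L_m(D₃)L_m(D₄)` (this is how the tripod
exchange C⁺ is read at the corner). [folklore] -/
theorem leading_mul_le_of_real_mul_le [Fintype ι] (E : Finset ι) (lam : ι → ℝ) (hlam : ∀ i ∈ E, 0 ≤ lam i)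
    (D₁ D₂ D₃ D₄ : Set (Set ι)) (m : ℕ)
    (h₁ : ∀ S ∈ E.powerset, (↑S : Set ι) ∈ D₁ → m ≤ (E \ S).card)
    (h₂ : ∀ S ∈ E.powerset, (↑S : Set ι) ∈ D₂ → m ≤ (E \ S).card)
    (h₃ : ∀ S ∈ E.powerset, (↑S : Set ι) ∈ D₃ → m ≤ (E \ S).card)
    (h₄ : ∀ S ∈ E.powerset, (↑S : Set ι) ∈ D₄ → m ≤ (E \ S).card)
    (hle : ∀ᶠ ε in 𝓝[>] (0 : ℝ),
      (prodBernoulli (cornerWeight E lam ε)).real D₁ * (prodBernoulli (cornerWeight E lam ε)).real D₂ ≤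
        (prodBernoulli (cornerWeight E lam ε)).real D₃ * (prodBernoulli (cornerWeight E lam ε)).real D₄) :
    leading E lam D₁ m * leading E lam D₂ m ≤ leading E lam D₃ m * leading E lam D₄ m := by
  have t₁ := tendsto_real_div_pow E lam hlam D₁ m h₁
  have t₂ := tendsto_real_div_pow E lam hlam D₂ m h₂
  have t₃ := tendsto_real_div_pow E lam hlam D₃ m h₃
  have t₄ := tendsto_real_div_pow E lam hlam D₄ m h₄
  refine le_of_tendsto_of_tendsto (t₁.mul t₂) (t₃.mul t₄) ?_
  filter_upwards [hle, eventually_small E lam hlam] with ε hε hs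
  have hpow : 0 < ε ^ m := pow_pos hs.1 m
  rw [div_mul_div_comm, div_mul_div_comm]
  exact div_le_div_of_nonneg_right hε (mul_pos hpow hpow).le

/-- **Eventual domination from leading coefficients.** If `D₁, D₂` have order `≥ m`, `0 < L_m(D₂)` and
`L_m(D₁) ≤ L_m(D₂)`, then for every `γ > 0`, eventually `P_ε(D₁) ≤ (1 + γ)·P_ε(D₂)`. [folklore] -/
theorem eventually_real_le_mul_of_leading_le [Fintype ι] (E : Finset ι) (lam : ι → ℝ) (hlam : ∀ i ∈ E, 0 ≤ lam i)
    (D₁ D₂ : Set (Set ι)) (m : ℕ)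
    (h₁ : ∀ S ∈ E.powerset, (↑S : Set ι) ∈ D₁ → m ≤ (E \ S).card)
    (h₂ : ∀ S ∈ E.powerset, (↑S : Set ι) ∈ D₂ → m ≤ (E \ S).card)
    (hpos : 0 < leading E lam D₂ m) (hle : leading E lam D₁ m ≤ leading E lam D₂ m) {γ : ℝ} (hγ : 0 < γ) :
    ∀ᶠ ε in 𝓝[>] (0 : ℝ), (prodBernoulli (cornerWeight E lam ε)).real D₁ ≤
      (1 + γ) * (prodBernoulli (cornerWeight E lam ε)).real D₂ := by
  have h := tendsto_real_div_real E lam hlam D₁ D₂ m h₁ h₂ hpos.ne'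
  have hlt : leading E lam D₁ m / leading E lam D₂ m < 1 + γ := by
    rw [div_lt_iff₀ hpos]; nlinarith
  have hev := h.eventually (gt_mem_nhds hlt)
  have hpos₂ : ∀ᶠ ε in 𝓝[>] (0 : ℝ), 0 < (prodBernoulli (cornerWeight E lam ε)).real D₂ := by
    have t₂ := tendsto_real_div_pow E lam hlam D₂ m h₂
    filter_upwards [t₂.eventually (lt_mem_nhds hpos), eventually_small E lam hlam] with ε hε hs
    have hpow : 0 < ε ^ m := pow_pos hs.1 m
    by_contra hneg
    have hneg' : (prodBernoulli (cornerWeight E lam ε)).real D₂ ≤ 0 := not_lt.mp hneg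
    have : (prodBernoulli (cornerWeight E lam ε)).real D₂ / ε ^ m ≤ 0 :=
      div_nonpos_of_nonpos_of_nonneg hneg' hpow.le
    linarith
  filter_upwards [hev, hpos₂] with ε hε hp
  rw [div_lt_iff₀ hp] at hε
  exact hε.le

end Corner

end Summit.CriticalPhenomena.PercolationContinuityZ3.Theorems

end
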